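import Mathlib
import Summits.Ventures.HodgeRepro.Tier4.Line1.StrongApproximation
import Summits.Ventures.HodgeRepro.Tier4.Line1.InfiniteLattice
import Summits.Ventures.HodgeRepro.Tier4.Line1.AdeleCocompactAssembly
import Summits.Ventures.HodgeRepro.Tier4.Line1.AdelicBlichfeldt

/-!
# Tier4/Line1/AdeleCocompact — `𝔸_k / k` IS COMPACT (rung C3, unconditional) and adelic Blichfeldt (rung C4)

Blind re-derivation cell `pub-hodge-repro`, Tier 4 (README §9–§10), seat t4-L1-p5 (prover, LINE L1, gen 0).
The two inputs of `Tier4/Line1/AdeleCocompactAssembly.lean` are now in the tree — C1 strong approximation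
(`exists_rational_sub_mem_integers`, t4-L1-p1, StrongApproximation.lean) and C2 the archimedean lattice
(`exists_compact_add_ringOfIntegers_infinite`, t4-L3-p2, InfiniteLattice.lean) — so «`𝔸_k/k` is compact» holds by
name, and with it the adelic Blichfeldt lemma for `k⁴ ⊆ 𝔸_k⁴`.  Mathlib (rev 81a5d257c8e4) has neither.

Nothing here says anything about the status of the Hodge conjecture for CM abelian varieties, which is NOT proved
(HC_CM is NOT proved by anyone in this repository).
-/

set_option autoImplicit false

noncomputable section

namespace Summit.Ventures.HodgeRepro.Tier4.Line1

open NumberField MeasureTheory Topology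
open scoped ENNReal

variable (k : Type) [Field k] [NumberField k]

/-- (C3) **`𝔸_k / k` is compact**: a compact `C ⊆ 𝔸_k` with `k + C = 𝔸_k`. -/
theorem exists_compact_add_principal :
    ∃ C : Set (AdeleRing (𝓞 k) k), IsCompact C ∧
      ∀ x : AdeleRing (𝓞 k) k, ∃ a : k, x - algebraMap k (AdeleRing (𝓞 k) k) a ∈ C :=
  exists_compact_add_principal_of k (exists_rational_sub_mem_integers k)
    (exists_compact_add_ringOfIntegers_infinite k)

/-- (C4) **Adelic Blichfeldt** for `k⁴ ⊆ 𝔸_k⁴`, unconditional. -/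
theorem exists_ne_zero_rational_mem_sub [MeasurableSpace (Fin 4 → AdeleRing (𝓞 k) k)]
    [BorelSpace (Fin 4 → AdeleRing (𝓞 k) k)] (μ : Measure (Fin 4 → AdeleRing (𝓞 k) k))
    [μ.IsAddHaarMeasure] :
    ∃ c : ℝ≥0∞, c < ∞ ∧ ∀ S : Set (Fin 4 → AdeleRing (𝓞 k) k), MeasurableSet S → c < μ S →
      ∃ x : Fin 4 → k, x ≠ 0 ∧ ∃ s ∈ S, ∃ t ∈ S,
        s - t = fun i => algebraMap k (AdeleRing (𝓞 k) k) (x i) :=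
  exists_ne_zero_rational_mem_sub_of k (exists_compact_add_principal k) μ

end Summit.Ventures.HodgeRepro.Tier4.Line1

end
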